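import Literature.NumberTheory.Automorphic.CompletedCohomologyHeckeAlgebraGLn

/-!
# Level-one dyadic reciprocity — part 14a «FiniteLevel / Engine»: levelwise factorisation of continuous points of the completed-cohomology Hecke algebra

Decomposition cell decomp-langlands, lens 4 «minimal counterexample / extremal reduction», gen 18 (node `FiniteLevelTorsionSplit`, ENGINE half; the
node half is `Theorems/LevelOneDyadicFiniteLevel.lean`, which imports this file).

THE ENGINE (hypothesis-free: any rank `n`, number field `K`, prime `p`, tame level `𝒰 : BigHeckeGLn.TameLevel n K p`; no commutativity of the Hecke
algebra and no algebraic closedness of the coefficients is used).  Let `𝕋 = CompletedCohomologyHeckeAlgebraGLn 𝒰 ⊆ ∏_{(r,s,i)} End(H^i(X_{U_r}, ℤ/p^s))` be the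
tree's completed-cohomology Hecke algebra (closure of the subring generated by the `T_{v,j}`, `v ∉ S`, in the product of the DISCRETE finite-level
endomorphism rings) and `k` a discrete field.  Then every CONTINUOUS ring homomorphism `ψ : 𝕋 → k` FACTORS THROUGH ONE FINITE LEVEL:
`ψ = ψ' ∘ toLevel idx` for some index `idx = (r, s, i)` and some `ψ' : 𝕋(U_r, ℤ/p^s, i) → k` on the finite-level Hecke algebra
`TameLevel.levelHeckeSubring idx` (`exists_levelwise`).  Proof: (A) `{0} ⊆ k` is open, so `ker ψ` is open in the subspace topology of the product of
discrete rings, hence contains `{T ∈ 𝕋 | T_idx = 0 ∀ idx ∈ J}` for a FINITE set `J` of indices (`exists_finset_vanishing`, `isOpen_pi_iff`);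
(B) THE DOMAIN TRICK (`exists_mem_forall_map_eq_zero`): the sets `N_idx = {T | T_idx = 0}` are two-sided ideals and `ψ(ab) = ψ(a)ψ(b)` with `k` a
domain, so by induction on `J` one index `idx ∈ J` already has `N_idx ⊆ ker ψ` (if `a ∈ N_{j₀}` has `ψ a ≠ 0`, then `ψ b = 0` whenever `b` vanishes on
`J ∖ {j₀}`, since `ab` vanishes on all of `J`); (C) the coordinate projection `toLevel idx : 𝕋 → 𝕋(U_r, ℤ/p^s, i)` is a SURJECTIVE continuous ring
homomorphism (`toLevel_surjective`: the finite level is generated by the images of the generators; `apply_mem_levelHeckeSubring`: the image of the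
closure lies in the closed = discrete finite level) sending `T_{v,j}` to `T_{v,j}` (`toLevel_heckeT`), and `ψ` descends along it
(`RingHom.liftOfRightInverse`).  COROLLARY (`isPadicallyAutomorphic_iff_levelwise`): a framed Galois representation `τ` with coefficients in a
discrete field is `p`-ADICALLY AUTOMORPHIC of tame level `𝒰` (tree `TameLevel.IsPadicallyAutomorphic`: associated with a continuous point of `𝕋`)
IFF it is associated (tree `IsAssociatedFamily`) with an eigensystem of ONE finite-level Hecke algebra read on the `levelHeckeT idx v j` — «`τ` OCCURS
in `H^i(X_{U_r}, ℤ/p^s)`».  This is the finite-level NORMAL FORM of a torsion avatar used by the node (support item FL of the child route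
`FiniteLevelTorsionSplit`, PROVED there by `finiteLevelNormalForm_holds`).

References: Scholze 2015, *On torsion in the cohomology of locally symmetric varieties*, Thm V.4.1 / Rem V.4.5 (the finite-level algebras
𝕋_{F,S}(K, i, m) and their inverse limit); Gee–Newton 2020, §2.1.3 (Def 2.1.5, Lemma 2.1.8: 𝕋(K^p) as a limit of finite ℤ/p^s-algebras, its open
maximal ideals); Emerton 2006/2011, local–global compatibility §5 (systems of Hecke eigenvalues in completed cohomology occur at finite level).
[folklore: proved here from the tree's construction, 0 sorry]
-/

set_option linter.dupNamespace false

namespace Summit.Langlands.Langlands.Theorems.LevelOneDyadic.FiniteLevel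

open Literature.NumberTheory.Automorphic BigHeckeGLn
open Literature.NumberTheory.GaloisRepresentations

/-- **The domain trick.** A ring homomorphism into a domain that kills every element lying in all the
two-sided ideals `N j` (`j ∈ J`, `J` finite) already kills one of them. [folklore] -/
theorem exists_mem_forall_map_eq_zero {ι B k : Type*} [Ring B] [Ring k] [IsDomain k]
    (ψ : B →+* k) (N : ι → Set B)
    (hl : ∀ j (a b : B), b ∈ N j → a * b ∈ N j) (hr : ∀ j (a b : B), a ∈ N j → a * b ∈ N j)
    (J : Finset ι) (hJ : ∀ b : B, (∀ j ∈ J, b ∈ N j) → ψ b = 0) :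
    ∃ j ∈ J, ∀ b ∈ N j, ψ b = 0 := by
  classical
  induction J using Finset.induction_on with
  | empty => exact absurd (hJ 1 (by simp)) (by simp)
  | insert j₀ J' hj₀ ih =>
    by_cases h0 : ∀ b ∈ N j₀, ψ b = 0
    · exact ⟨j₀, Finset.mem_insert_self _ _, h0⟩
    · simp only [not_forall, exists_prop] at h0
      obtain ⟨a, ha, hψa⟩ := h0
      have hJ' : ∀ b : B, (∀ j ∈ J', b ∈ N j) → ψ b = 0 := by
        intro b hb
        have hab : ψ (a * b) = 0 := hJ (a * b) (by
          intro j hj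
          rcases Finset.mem_insert.mp hj with rfl | hj
          · exact hr _ a b ha
          · exact hl _ a b (hb j hj))
        rw [map_mul] at hab
        exact (mul_eq_zero.mp hab).resolve_left hψa
      obtain ⟨j, hj, h⟩ := ih hJ'
      exact ⟨j, Finset.mem_insert_of_mem hj, h⟩

variable {n : ℕ} {K : Type} [Field K] [NumberField K] {p : ℕ} [Fact p.Prime] (𝒰 : TameLevel n K p)

/-- **Open kernel ⇒ finite support.** A continuous homomorphism from `𝕋(K^p)` (a subspace of the
product of the DISCRETE finite-level endomorphism rings) to a discrete ring vanishes on every element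
whose components at a fixed FINITE set of indices `(r, s, i)` vanish. [folklore] -/
theorem exists_finset_vanishing {k : Type*} [Ring k] [TopologicalSpace k] [DiscreteTopology k]
    (ψ : CompletedCohomologyHeckeAlgebraGLn 𝒰 →+* k) (hψ : Continuous ψ) :
    ∃ J : Finset (ℕ × ℕ × ℕ), ∀ T : CompletedCohomologyHeckeAlgebraGLn 𝒰,
      (∀ idx ∈ J, (T : 𝒰.bigEnd) idx = 0) → ψ T = 0 := by
  have hopen : IsOpen (ψ ⁻¹' {0}) := (isOpen_discrete _).preimage hψ
  obtain ⟨V, hV, hVeq⟩ := isOpen_induced_iff.mp hopen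
  have h0V : (0 : 𝒰.bigEnd) ∈ V := by
    have h0 : (0 : CompletedCohomologyHeckeAlgebraGLn 𝒰) ∈ Subtype.val ⁻¹' V := by
      rw [hVeq]; simp
    exact h0
  obtain ⟨I, u, hu, hIu⟩ := isOpen_pi_iff.mp hV 0 h0V
  refine ⟨I, fun T hT => ?_⟩
  have hTV : (T : 𝒰.bigEnd) ∈ V := by
    refine hIu (Set.mem_pi.mpr fun idx hidx => ?_)
    rw [hT idx (Finset.mem_coe.mp hidx)]
    exact (hu idx (Finset.mem_coe.mp hidx)).2
  have hT0 : T ∈ ψ ⁻¹' {0} := by rw [← hVeq]; exact hTV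
  simpa using hT0

/-- Components of elements of `𝕋(K^p)` lie in the finite-level Hecke algebras `𝕋(U_r, ℤ/p^s, i)`
(the factor is discrete, so the image of the closure is the image). [folklore] -/
theorem apply_mem_levelHeckeSubring (T : CompletedCohomologyHeckeAlgebraGLn 𝒰) (idx : ℕ × ℕ × ℕ) :
    (T : 𝒰.bigEnd) idx ∈ 𝒰.levelHeckeSubring idx := by
  have hT : (T : 𝒰.bigEnd) ∈ closure ((Subring.closure 𝒰.heckeGenerators : Subring 𝒰.bigEnd) :
      Set 𝒰.bigEnd) := T.2
  have hcont : Continuous (fun S : 𝒰.bigEnd => S idx) := continuous_apply idx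
  have h1 : (T : 𝒰.bigEnd) idx ∈ closure ((fun S : 𝒰.bigEnd => S idx) ''
      ((Subring.closure 𝒰.heckeGenerators : Subring 𝒰.bigEnd) : Set 𝒰.bigEnd)) :=
    image_closure_subset_closure_image hcont ⟨_, hT, rfl⟩
  have himage : (fun S : 𝒰.bigEnd => S idx) ''
      ((Subring.closure 𝒰.heckeGenerators : Subring 𝒰.bigEnd) : Set 𝒰.bigEnd) =
      ((𝒰.levelHeckeSubring idx : Subring (𝒰.EndFactor idx)) : Set (𝒰.EndFactor idx)) := by
    have hmap := RingHom.map_closure (Pi.evalRingHom (fun i => 𝒰.EndFactor i) idx) 𝒰.heckeGenerators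
    have hc : ((Subring.closure 𝒰.heckeGenerators).map (Pi.evalRingHom (fun i => 𝒰.EndFactor i) idx) :
        Set (𝒰.EndFactor idx)) = (fun S : 𝒰.bigEnd => S idx) ''
        ((Subring.closure 𝒰.heckeGenerators : Subring 𝒰.bigEnd) : Set 𝒰.bigEnd) := Subring.coe_map _ _
    rw [← hc, hmap]
    rfl
  rw [himage, (isClosed_discrete _).closure_eq] at h1
  exact h1

/-- **The level projection** `𝕋(K^p) → 𝕋(U_r, ℤ/p^s, i)`, `T ↦ T_{(r,s,i)}`. [folklore] -/
noncomputable def toLevel (idx : ℕ × ℕ × ℕ) :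
    CompletedCohomologyHeckeAlgebraGLn 𝒰 →+* 𝒰.levelHeckeSubring idx :=
  ((Pi.evalRingHom (fun i => 𝒰.EndFactor i) idx).comp 𝒰.bigHeckeSubring.subtype).codRestrict
    (𝒰.levelHeckeSubring idx) (fun T => apply_mem_levelHeckeSubring 𝒰 T idx)

/-- Unfolding lemma: the level projection is the `idx`-component. [folklore] -/
theorem coe_toLevel (idx : ℕ × ℕ × ℕ) (T : CompletedCohomologyHeckeAlgebraGLn 𝒰) :
    (toLevel 𝒰 idx T : 𝒰.EndFactor idx) = (T : 𝒰.bigEnd) idx := rfl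

/-- The level projection is onto: `𝕋(U_r, ℤ/p^s, i)` is generated by the images of the generators,
all of which lie in `𝕋(K^p)`. [folklore] -/
theorem toLevel_surjective (idx : ℕ × ℕ × ℕ) : Function.Surjective (toLevel 𝒰 idx) := by
  rintro ⟨x, hx⟩
  have hx' : x ∈ (Subring.closure 𝒰.heckeGenerators).map
      (Pi.evalRingHom (fun i => 𝒰.EndFactor i) idx) := by
    rw [RingHom.map_closure]; exact hx
  obtain ⟨S, hS, hSx⟩ := Subring.mem_map.mp hx'
  exact ⟨⟨S, (Subring.closure 𝒰.heckeGenerators).le_topologicalClosure hS⟩, Subtype.ext hSx⟩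

/-- The level projection is continuous (a coordinate projection of the product, restricted and corestricted). [folklore] -/
theorem continuous_toLevel (idx : ℕ × ℕ × ℕ) : Continuous (toLevel 𝒰 idx) :=
  ((continuous_apply idx).comp continuous_subtype_val).subtype_mk _

/-- The level projection sends `T_{v,j} ∈ 𝕋(K^p)` to `T_{v,j} ∈ 𝕋(U_r, ℤ/p^s, i)`. [folklore] -/
theorem toLevel_heckeT (idx : ℕ × ℕ × ℕ)
    (v : IsDedekindDomain.HeightOneSpectrum (NumberField.RingOfIntegers K)) (j : ℕ) :
    toLevel 𝒰 idx (𝒰.heckeT v j) = 𝒰.levelHeckeT idx v j := by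
  classical
  apply Subtype.ext
  rw [coe_toLevel]
  by_cases hv : v ∈ 𝒰.bad
  · simp [TameLevel.heckeT, TameLevel.levelHeckeT, hv]
  · rw [𝒰.coe_heckeT hv]
    simp [TameLevel.levelHeckeT, hv]

/-- **Levelwise factorisation (the finite-level normal form).** Every continuous homomorphism from the
completed-cohomology Hecke algebra `𝕋(K^p)` to a DISCRETE FIELD factors through the projection to a
single finite-level Hecke algebra `𝕋(U_r, ℤ/p^s, i)`: open kernel ⇒ finitely many indices matter; the
domain trick ⇒ one index matters; descend along the surjection. [folklore] -/
theorem exists_levelwise {k : Type*} [Field k] [TopologicalSpace k] [DiscreteTopology k]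
    (ψ : CompletedCohomologyHeckeAlgebraGLn 𝒰 →+* k) (hψ : Continuous ψ) :
    ∃ (idx : ℕ × ℕ × ℕ) (ψ' : 𝒰.levelHeckeSubring idx →+* k), ψ'.comp (toLevel 𝒰 idx) = ψ := by
  classical
  obtain ⟨J, hJ⟩ := exists_finset_vanishing 𝒰 ψ hψ
  obtain ⟨idx, -, hidx⟩ := exists_mem_forall_map_eq_zero ψ
    (fun idx => {T : CompletedCohomologyHeckeAlgebraGLn 𝒰 | (T : 𝒰.bigEnd) idx = 0})
    (fun j a b hb => by
      simp only [Set.mem_setOf_eq] at hb ⊢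
      rw [Subring.coe_mul, Pi.mul_apply, hb, mul_zero])
    (fun j a b ha => by
      simp only [Set.mem_setOf_eq] at ha ⊢
      rw [Subring.coe_mul, Pi.mul_apply, ha, zero_mul])
    J (fun T hT => hJ T (fun idx hidx => hT idx hidx))
  have hker : RingHom.ker (toLevel 𝒰 idx) ≤ RingHom.ker ψ := by
    intro T hT
    rw [RingHom.mem_ker] at hT ⊢
    exact hidx T (by simpa [coe_toLevel] using congrArg Subtype.val hT)
  refine ⟨idx, (toLevel 𝒰 idx).liftOfRightInverse (Function.surjInv (toLevel_surjective 𝒰 idx))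
    (Function.rightInverse_surjInv (toLevel_surjective 𝒰 idx)) ⟨ψ, hker⟩, ?_⟩
  exact RingHom.liftOfRightInverse_comp _ _ _ _

/-- **Levelwise association.** A `p`-adically automorphic `τ` with DISCRETE field coefficients (a mod-`p`
torsion eigensystem of tame level `𝒰`) is associated with an eigensystem of ONE finite-level Hecke
algebra `𝕋(U_r, ℤ/p^s, i)`. [folklore] -/
theorem exists_levelwise_of_isPadicallyAutomorphic {k : Type*} [Field k] [TopologicalSpace k]
    [DiscreteTopology k] {τ : FramedGaloisRep K k n} (h : 𝒰.IsPadicallyAutomorphic τ) :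
    ∃ (idx : ℕ × ℕ × ℕ) (ψ' : 𝒰.levelHeckeSubring idx →+* k),
      IsAssociatedFamily n 𝒰.bad (fun v j => ψ' (𝒰.levelHeckeT idx v j)) τ := by
  obtain ⟨x, hx, hass⟩ := h
  obtain ⟨idx, ψ', hψ'⟩ := exists_levelwise 𝒰 x hx
  refine ⟨idx, ψ', ?_⟩
  have hfun : (fun v j => ψ' (𝒰.levelHeckeT idx v j)) = fun v j => x (𝒰.heckeT v j) := by
    funext v j
    rw [← toLevel_heckeT, ← RingHom.comp_apply, hψ']
  rw [hfun]
  exact hass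

/-- Conversely an eigensystem of one finite level, composed with the (continuous) level projection, is
a continuous point of `𝕋(K^p)`. [folklore] -/
theorem isPadicallyAutomorphic_of_levelwise {k : Type*} [Field k] [TopologicalSpace k]
    [DiscreteTopology k] {τ : FramedGaloisRep K k n} {idx : ℕ × ℕ × ℕ}
    (ψ' : 𝒰.levelHeckeSubring idx →+* k)
    (hass : IsAssociatedFamily n 𝒰.bad (fun v j => ψ' (𝒰.levelHeckeT idx v j)) τ) :
    𝒰.IsPadicallyAutomorphic τ := by
  have hc : Continuous ψ' := continuous_of_discreteTopology
  refine ⟨ψ'.comp (toLevel 𝒰 idx), hc.comp (continuous_toLevel 𝒰 idx), ?_⟩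
  have hfun : (fun v j => (ψ'.comp (toLevel 𝒰 idx)) (𝒰.heckeT v j)) =
      fun v j => ψ' (𝒰.levelHeckeT idx v j) := by
    funext v j
    rw [RingHom.comp_apply, toLevel_heckeT]
  show IsAssociatedFamily n 𝒰.bad (fun v j => (ψ'.comp (toLevel 𝒰 idx)) (𝒰.heckeT v j)) τ
  rw [hfun]
  exact hass

/-- **The finite-level normal form** of `p`-adic automorphy over a discrete field. [folklore] -/
theorem isPadicallyAutomorphic_iff_levelwise {k : Type*} [Field k] [TopologicalSpace k]
    [DiscreteTopology k] (τ : FramedGaloisRep K k n) :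
    𝒰.IsPadicallyAutomorphic τ ↔ ∃ (idx : ℕ × ℕ × ℕ) (ψ' : 𝒰.levelHeckeSubring idx →+* k),
      IsAssociatedFamily n 𝒰.bad (fun v j => ψ' (𝒰.levelHeckeT idx v j)) τ :=
  ⟨exists_levelwise_of_isPadicallyAutomorphic 𝒰, fun ⟨_, ψ', h⟩ => isPadicallyAutomorphic_of_levelwise 𝒰 ψ' h⟩

end Summit.Langlands.Langlands.Theorems.LevelOneDyadic.FiniteLevel
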